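import Summits.QuantumFields.YangMills.Theorems.BalabanUVNodesN15KingModelRandomWalkFree
import Summits.QuantumFields.YangMills.Theorems.BalabanUVNodesN15KingModelCovariantLinkDependence
import HarnessLib

/-!
# BalabanUVNodes ∕ N15 — THE KING-MODEL RUNG (PART Ͱ-l): THE RANDOM WALK EXPANSION OF THE COVARIANT FINE COVARIANCE AND KATO DOMINATION BY PRINT's ROUTE —
# `G_U = Σ_{k≥0} D₀^{−(k+1)}·T_U^k` (sum over walks of the ordered product of the link variables along the walk), termwise `‖(T_U^k)_{xy}‖ ≤ (T^k)(x,y)`, hence `‖(G_U)_{xy}‖ ≤ G(x,y)`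
# (Track A, DAG node N15 = NE2; FAN-OUT v1.1 §N15 s3 «KING-MODEL RUNG»; [Balaban1985BackgroundPropagators] p.398 «a random walk representation similar to that in (2.40)»; count-neutral)

HONEST FRAMING.  Count-neutral (cell `pub-ymgap`, seat `pub-ymgap-dag-n15-e` g42; `--supports stmt-QuantumFields-27247 --as helper` = K3ᴬ, KEY MAP v3).  One finite torus at fixed
spacing; the random walk expansion of the FINE covariant operator `−cΔ_U + m²` only (no block term) — the mechanism of [B9]'s proof of Thm 3.1 in its simplest instance, NOT the
expansion (2.40)∕(3.49) of `G_k(U)` with block resolvents, NOT (3.42); NOT a node discharge (N15 of record untouched); nothing continuum ∕ ℝ⁴ ∕ OS ∕ Clay.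

THE RESULT.  `M_U = −cΔ_U + m² = D₀·1 − T_U` with `D₀ = m²+2(d+1)c` and `T_U` the tree's hopping matrix `Hopping.hop U` of the King datum (blocks `(T_U)_{x,x+e_μ} = cU(x,μ)`,
`(T_U)_{x+e_μ,x} = cU(x,μ)^*`), `T = kingHop K c` its `U ≡ 1`, `n = 1` shadow (PART Ͱ-k).  For `c ≥ 0`, `m² > 0`, every fibre, EVERY unitary `U`:
* §1 `l2_opNorm_of_mem_unitaryGroup_le` (`‖V‖_{op} ≤ 1`), `norm_entry_le_l2_opNorm_blk` (`|A((x,i),(y,j))| ≤ ‖A_{xy}‖_{op}`), `blk_one'`, `l2_opNorm_blk_one_le`, ★ `blk_hop`, ★ **`l2_opNorm_blk_hop_le`**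
  (`‖(T_U)_{xy}‖ ≤ T(x,y)`);
* §2 ★★ **`l2_opNorm_blk_pow_le`** (generic: `‖A_{xy}‖ ≤ t(x,y)` for all blocks ⟹ `‖(A^k)_{xy}‖ ≤ (t^k)(x,y)` — a walk of `k` unitaries has norm `≤ 1`), ★★ **`norm_hop_pow_entry_le`**
  (`|(T_U^k)((x,i),(y,j))| ≤ (T^k)(x,y)`);
* §3 `covLapF_eq_smul`, ★ `covLapF_mul_partialSum` (`M_U·Σ_{k<N}D₀^{−(k+1)}T_U^k = 1 − (D₀⁻¹T_U)^N`), ★ `partialSum_eq_inv_sub`, `norm_remainder_entry_le` (`≤ (Σ_r|G_U(p,r)|)·θ^N`, `θ = 2(d+1)c∕D₀ < 1`),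
  ★★★ **`hasSum_covariant_randomWalk`** — THE RANDOM WALK REPRESENTATION `G_U((x,i),(y,j)) = Σ_{k≥0} D₀^{−(k+1)}·(T_U^k)((x,i),(y,j))` at every unitary `U` (absolutely convergent, dominated
  termwise by the free expansion of PART Ͱ-k), ★★ `norm_randomWalk_term_le`;
* §4 ★★★ **`norm_inv_entry_le_lapF_inv'`** — KATO DOMINATION BY PRINT's ROUTE: `|G_U((x,i),(y,j))| ≤ Σ_k D₀^{−(k+1)}(T^k)(x,y) = G(x,y)` (`norm_tsum_le_tsum_norm` + Ͱ-k `hasSum_kingHop_randomWalk`) — the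
  same inequality as Ͱ-b `norm_inv_entry_le_lapF_inv`, now obtained as in [B9] p.398 rather than by the maximum principle.

PRIOR TREE ART (by name): Ͱ-a (`covLapF`, `covLapF_eq`, `blk_covLapF`, `covLapF_inv_mul`, `kingHopping`), Ͱ-b (`norm_toEuclideanLin_of_mem_unitaryGroup`), Ͱ-g (`blk_sub'`, `blk_mul'`), Ͱ-k (`kingHop`, `kingHop_nonneg`,
`kingHop_pow_nonneg`, `sum_smul_kingHop_pow_row`, `theta_lt_one`, `hasSum_kingHop_randomWalk`), `LatticeDiamagneticInequality` (`blk`, `Hopping.hop`), Mathlib (`mul_neg_geom_sum`,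
`Summable.of_norm_bounded`, `HasSum.tendsto_sum_nat`, `norm_tsum_le_tsum_norm`, `Matrix.Norms.L2Operator`).  Dedup (rg at filing): basename 0 files; needles
`hasSum_covariant_randomWalk|l2_opNorm_blk_pow_le|norm_hop_pow_entry_le|norm_inv_entry_le_lapF_inv'` 0 tree files.  Locators: [Balaban1985BackgroundPropagators] p.398 l.3–6, (2.40) p.393, (3.23)
p.394, (3.42) p.397; [King1986] (4.4) p.670; [DodziukMathai2006] Thm 1.5 §1 (the inequality re-derived).  0 `sorry`, 0 `def`.
-/

noncomputable section

open scoped BigOperators ComplexConjugate ComplexOrder Topology Matrix.Norms.L2Operator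
open Finset Matrix WithLp Filter

namespace Summit.QuantumFields.YangMills.BalabanUVNodes.N15KingModelRung.Covariant

open Literature.MathematicalPhysics.QuantumFieldTheory.LatticeDiamagneticInequality (Hopping blk)
open Literature.MathematicalPhysics.QuantumFieldTheory.Balaban1983to89.B5Prop11Plancherel (Tor unitVec)
open Literature.MathematicalPhysics.QuantumFieldTheory.King1986.Torus (lapF)

variable {d : ℕ} (K : Fin (d + 1) → ℕ) [hK : ∀ μ, NeZero (K μ)]
variable {𝕜 : Type*} [RCLike 𝕜] {n : Type*} [Fintype n] [DecidableEq n] {c m2 : ℝ}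

/-! ## §1 Block norms: unitaries, entries, the identity, the hopping matrix -/

omit hK in
/-- A unitary matrix has operator norm `≤ 1` (an isometry of `EuclideanSpace 𝕜 n`). [folklore] -/
theorem l2_opNorm_of_mem_unitaryGroup_le {V : Matrix n n 𝕜} (hV : V ∈ Matrix.unitaryGroup n 𝕜) : ‖V‖ ≤ 1 := by
  rw [Matrix.cstar_norm_def]
  refine ContinuousLinearMap.opNorm_le_bound _ zero_le_one fun w => ?_
  have hw : w = toLp 2 (ofLp w) := rfl
  rw [hw, Matrix.toEuclideanCLM_toLp, one_mul, ← Matrix.toLpLin_apply, norm_toEuclideanLin_of_mem_unitaryGroup hV]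

omit hK in
/-- An entry is bounded by the operator norm of its block: `|A((x,i),(y,j))| ≤ ‖A_{xy}‖_{op}`. [folklore] -/
theorem norm_entry_le_l2_opNorm_blk (A : Matrix (Tor K × n) (Tor K × n) 𝕜) (x y : Tor K) (i j : n) : ‖A (x, i) (y, j)‖ ≤ ‖blk A x y‖ := by
  have h1 : ‖(toLp 2 (blk A x y *ᵥ Pi.single j 1) : EuclideanSpace 𝕜 n)‖ ≤ ‖blk A x y‖ := by
    have h := (Matrix.toEuclideanCLM (n := n) (𝕜 := 𝕜) (blk A x y)).le_opNorm (toLp 2 (Pi.single j 1))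
    rw [Matrix.toEuclideanCLM_toLp, PiLp.toLp_single, PiLp.norm_single, norm_one, mul_one, ← Matrix.cstar_norm_def] at h
    exact h
  refine le_trans ?_ h1
  have := PiLp.norm_apply_le (toLp 2 (blk A x y *ᵥ Pi.single j (1 : 𝕜)) : EuclideanSpace 𝕜 n) i
  simpa only [PiLp.toLp_apply, mulVec_single_one, Matrix.col_apply, blk, Matrix.of_apply] using this

omit hK [Fintype n] in
/-- Blocks of the identity. [folklore] -/
theorem blk_one' (x y : Tor K) : blk (1 : Matrix (Tor K × n) (Tor K × n) 𝕜) x y = if x = y then 1 else 0 := by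
  ext i j
  simp only [blk, Matrix.of_apply, Matrix.one_apply, Prod.mk.injEq]
  by_cases h : x = y
  · subst h; simp [Matrix.one_apply]
  · simp [h]

omit hK in
/-- `‖(1)_{xy}‖ ≤ [x = y]`. [folklore] -/
theorem l2_opNorm_blk_one_le (x y : Tor K) : ‖blk (1 : Matrix (Tor K × n) (Tor K × n) 𝕜) x y‖ ≤ (1 : Matrix (Tor K) (Tor K) ℝ) x y := by
  rw [blk_one', Matrix.one_apply]
  split_ifs
  · exact l2_opNorm_of_mem_unitaryGroup_le (Submonoid.one_mem _)
  · rw [norm_zero]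

omit [Fintype n] in
/-- ★ THE BLOCKS OF THE HOPPING MATRIX: `(T_U)_{xy} = c·Σ_μ([y=x+e_μ]U(x,μ) + [y=x−e_μ]U(x−e_μ,μ)^*)`. [cite: Balaban1985BackgroundPropagators, (3.23) p.394] -/
theorem blk_hop (c m2 : ℝ) (U : Tor K × Fin (d + 1) → Matrix n n 𝕜) (x y : Tor K) :
    blk ((kingHopping K c m2).hop U) x y
      = (c : 𝕜) • ∑ μ, ((if y = x + unitVec K μ then U (x, μ) else 0) + (if y = x - unitVec K μ then (U (x - unitVec K μ, μ))ᴴ else 0)) := by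
  have h : (kingHopping K c m2).hop U = diagonal (fun _ : Tor K × n => ((m2 + 2 * ((d : ℝ) + 1) * c : ℝ) : 𝕜)) - covLapF K c m2 U := by
    rw [covLapF_eq]; abel
  have hdiag : blk (diagonal (fun _ : Tor K × n => ((m2 + 2 * ((d : ℝ) + 1) * c : ℝ) : 𝕜))) x y
      = if x = y then (((m2 + 2 * ((d : ℝ) + 1) * c : ℝ) : 𝕜) • (1 : Matrix n n 𝕜)) else 0 := by
    ext i j
    simp only [blk, Matrix.of_apply, diagonal_apply, Prod.mk.injEq]
    by_cases hxy : x = y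
    · subst hxy; simp [Matrix.one_apply]
    · simp [hxy]
  rw [h, blk_sub', hdiag, blk_covLapF, sub_sub_cancel]

/-- ★ **THE HOPPING BLOCKS ARE DOMINATED BY KING's HOPPING MATRIX**: `‖(T_U)_{xy}‖_{op} ≤ T(x,y)` for unitary `U`, `c ≥ 0` (each block is `c` times a unitary or zero).
[cite: Balaban1985BackgroundPropagators, (3.23) p.394, p.398] -/
theorem l2_opNorm_blk_hop_le (hc : 0 ≤ c) (m2 : ℝ) {U : Tor K × Fin (d + 1) → Matrix n n 𝕜} (hU : ∀ b, U b ∈ Matrix.unitaryGroup n 𝕜) (x y : Tor K) :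
    ‖blk ((kingHopping K c m2).hop U) x y‖ ≤ kingHop K c x y := by
  rw [blk_hop, kingHop, norm_smul, RCLike.norm_ofReal, abs_of_nonneg hc]
  refine mul_le_mul_of_nonneg_left ((norm_sum_le _ _).trans (Finset.sum_le_sum fun μ _ => (norm_add_le _ _).trans (add_le_add ?_ ?_))) hc
  · split_ifs
    · exact l2_opNorm_of_mem_unitaryGroup_le (hU _)
    · rw [norm_zero]
  · split_ifs
    · rw [Matrix.l2_opNorm_conjTranspose]; exact l2_opNorm_of_mem_unitaryGroup_le (hU _)
    · rw [norm_zero]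

/-! ## §2 Walks of unitaries: `‖(A^k)_{xy}‖ ≤ (t^k)(x,y)` -/

/-- ★★ **POWERS ARE DOMINATED BLOCKWISE**: if `‖A_{xy}‖_{op} ≤ t(x,y)` for all `x, y`, then `‖(A^k)_{xy}‖_{op} ≤ (t^k)(x,y)` for all `k` — the blocks of `A^k` are sums over `k`-step
walks of ordered products of blocks, each product of norm at most the product of the weights. [cite: Balaban1985BackgroundPropagators, p.398 l.3–6] -/
theorem l2_opNorm_blk_pow_le {A : Matrix (Tor K × n) (Tor K × n) 𝕜} {t : Matrix (Tor K) (Tor K) ℝ} (ht : ∀ x y, ‖blk A x y‖ ≤ t x y) :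
    ∀ (k : ℕ) (x y : Tor K), ‖blk (A ^ k) x y‖ ≤ (t ^ k) x y
  | 0, x, y => by rw [pow_zero, pow_zero]; exact l2_opNorm_blk_one_le K x y
  | k + 1, x, y => by
      rw [pow_succ, pow_succ, blk_mul', Matrix.mul_apply]
      refine (norm_sum_le _ _).trans (Finset.sum_le_sum fun z _ => (norm_mul_le _ _).trans ?_)
      exact mul_le_mul (l2_opNorm_blk_pow_le ht k x z) (ht z y) (norm_nonneg _) ((norm_nonneg _).trans (l2_opNorm_blk_pow_le ht k x z))

/-- ★★ **THE COVARIANT WALKS ARE DOMINATED BY THE FREE WALKS**: `|(T_U^k)((x,i),(y,j))| ≤ ‖(T_U^k)_{xy}‖_{op} ≤ (T^k)(x,y)` at every unitary `U`.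
[cite: Balaban1985BackgroundPropagators, p.398 l.3–6; DodziukMathai2006, Thm 1.5 §1] -/
theorem norm_hop_pow_entry_le (hc : 0 ≤ c) (m2 : ℝ) {U : Tor K × Fin (d + 1) → Matrix n n 𝕜} (hU : ∀ b, U b ∈ Matrix.unitaryGroup n 𝕜)
    (k : ℕ) (x y : Tor K) (i j : n) : ‖((kingHopping K c m2).hop U ^ k) (x, i) (y, j)‖ ≤ (kingHop K c ^ k) x y :=
  (norm_entry_le_l2_opNorm_blk K _ x y i j).trans (l2_opNorm_blk_pow_le K (l2_opNorm_blk_hop_le K hc m2 hU) k x y)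

/-! ## §3 The covariant random walk expansion -/

omit [Fintype n] in
/-- `M_U = D₀·(1 − D₀⁻¹T_U)`. [cite: Balaban1985BackgroundPropagators, (3.23) p.394] -/
theorem covLapF_eq_smul (hc : 0 ≤ c) (hm : 0 < m2) (U : Tor K × Fin (d + 1) → Matrix n n 𝕜) :
    covLapF K c m2 U = ((m2 + 2 * ((d : ℝ) + 1) * c : ℝ) : 𝕜) • (1 - (((m2 + 2 * ((d : ℝ) + 1) * c : ℝ) : 𝕜)⁻¹) • (kingHopping K c m2).hop U) := by
  have hD0 : (((m2 + 2 * ((d : ℝ) + 1) * c : ℝ) : 𝕜)) ≠ 0 := by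
    rw [Ne, RCLike.ofReal_eq_zero]; exact (ne_of_gt (by positivity))
  rw [covLapF_eq, smul_sub, smul_smul, mul_inv_cancel₀ hD0, one_smul]
  congr 1
  ext p q
  simp only [diagonal_apply, Matrix.smul_apply, Matrix.one_apply, smul_eq_mul, mul_ite, mul_one, mul_zero]

/-- ★ THE TELESCOPING IDENTITY: `M_U·Σ_{k<N}D₀^{−(k+1)}T_U^k = 1 − (D₀⁻¹T_U)^N`. [cite: Balaban1985BackgroundPropagators, p.398] -/
theorem covLapF_mul_partialSum (hc : 0 ≤ c) (hm : 0 < m2) (U : Tor K × Fin (d + 1) → Matrix n n 𝕜) (N : ℕ) :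
    covLapF K c m2 U * ∑ k ∈ Finset.range N, ((((m2 + 2 * ((d : ℝ) + 1) * c : ℝ) : 𝕜)⁻¹) ^ (k + 1)) • (kingHopping K c m2).hop U ^ k
      = 1 - ((((m2 + 2 * ((d : ℝ) + 1) * c : ℝ) : 𝕜)⁻¹) • (kingHopping K c m2).hop U) ^ N := by
  set D0 : 𝕜 := ((m2 + 2 * ((d : ℝ) + 1) * c : ℝ) : 𝕜) with hD0def
  have hD0 : D0 ≠ 0 := by rw [hD0def, Ne, RCLike.ofReal_eq_zero]; exact (ne_of_gt (by positivity))
  have hsum : ∑ k ∈ Finset.range N, (D0⁻¹ ^ (k + 1)) • (kingHopping K c m2).hop U ^ k = D0⁻¹ • ∑ k ∈ Finset.range N, (D0⁻¹ • (kingHopping K c m2).hop U) ^ k := by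
    rw [Finset.smul_sum]
    refine Finset.sum_congr rfl fun k _ => ?_
    rw [smul_pow, smul_smul, pow_succ', mul_comm]
  rw [covLapF_eq_smul K hc hm U, hsum, smul_mul_smul_comm, mul_inv_cancel₀ hD0, one_smul, mul_neg_geom_sum]

/-- ★ THE PARTIAL SUMS: `Σ_{k<N}D₀^{−(k+1)}T_U^k = G_U − G_U·(D₀⁻¹T_U)^N`. [cite: Balaban1985BackgroundPropagators, p.398] -/
theorem partialSum_eq_inv_sub (hc : 0 ≤ c) (hm : 0 < m2) {U : Tor K × Fin (d + 1) → Matrix n n 𝕜} (hU : ∀ b, U b ∈ Matrix.unitaryGroup n 𝕜) (N : ℕ) :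
    ∑ k ∈ Finset.range N, ((((m2 + 2 * ((d : ℝ) + 1) * c : ℝ) : 𝕜)⁻¹) ^ (k + 1)) • (kingHopping K c m2).hop U ^ k
      = (covLapF K c m2 U)⁻¹ - (covLapF K c m2 U)⁻¹ * ((((m2 + 2 * ((d : ℝ) + 1) * c : ℝ) : 𝕜)⁻¹) • (kingHopping K c m2).hop U) ^ N := by
  have h := congrArg ((covLapF K c m2 U)⁻¹ * ·) (covLapF_mul_partialSum K hc hm U N)
  rwa [← Matrix.mul_assoc, covLapF_inv_mul K hc hm hU, Matrix.one_mul, Matrix.mul_sub, Matrix.mul_one] at h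

/-- The entries of `(D₀⁻¹T_U)^N` are `≤ θ^N`, `θ = 2(d+1)c∕D₀`. [cite: Balaban1985BackgroundPropagators, p.398] -/
theorem norm_smul_hop_pow_entry_le (hc : 0 ≤ c) (hm : 0 < m2) {U : Tor K × Fin (d + 1) → Matrix n n 𝕜} (hU : ∀ b, U b ∈ Matrix.unitaryGroup n 𝕜)
    (N : ℕ) (p q : Tor K × n) :
    ‖(((((m2 + 2 * ((d : ℝ) + 1) * c : ℝ) : 𝕜)⁻¹) • (kingHopping K c m2).hop U) ^ N) p q‖ ≤ (2 * ((d : ℝ) + 1) * c / (m2 + 2 * ((d : ℝ) + 1) * c)) ^ N := by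
  obtain ⟨x, i⟩ := p
  obtain ⟨y, j⟩ := q
  have hD0 : 0 < m2 + 2 * ((d : ℝ) + 1) * c := by positivity
  rw [smul_pow, Matrix.smul_apply, norm_smul, norm_pow, norm_inv, RCLike.norm_ofReal, abs_of_pos hD0]
  calc (m2 + 2 * ((d : ℝ) + 1) * c)⁻¹ ^ N * ‖((kingHopping K c m2).hop U ^ N) (x, i) (y, j)‖
      ≤ (m2 + 2 * ((d : ℝ) + 1) * c)⁻¹ ^ N * (kingHop K c ^ N) x y :=
        mul_le_mul_of_nonneg_left (norm_hop_pow_entry_le K hc m2 hU N x y i j) (pow_nonneg (inv_nonneg.2 hD0.le) _)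
    _ = (((m2 + 2 * ((d : ℝ) + 1) * c)⁻¹ • kingHop K c) ^ N) x y := by rw [smul_pow, Matrix.smul_apply, smul_eq_mul]
    _ ≤ ∑ w, (((m2 + 2 * ((d : ℝ) + 1) * c)⁻¹ • kingHop K c) ^ N) x w :=
        Finset.single_le_sum (fun w _ => by rw [smul_pow, Matrix.smul_apply, smul_eq_mul]; exact mul_nonneg (pow_nonneg (inv_nonneg.2 hD0.le) _) (kingHop_pow_nonneg K hc N x w))
          (Finset.mem_univ y)
    _ = (2 * ((d : ℝ) + 1) * c / (m2 + 2 * ((d : ℝ) + 1) * c)) ^ N := sum_smul_kingHop_pow_row K c m2 N x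

/-- The remainder entry: `|(G_U·(D₀⁻¹T_U)^N)(p,q)| ≤ (Σ_r|G_U(p,r)|)·θ^N`. [cite: Balaban1985BackgroundPropagators, p.398] -/
theorem norm_remainder_entry_le (hc : 0 ≤ c) (hm : 0 < m2) {U : Tor K × Fin (d + 1) → Matrix n n 𝕜} (hU : ∀ b, U b ∈ Matrix.unitaryGroup n 𝕜)
    (N : ℕ) (p q : Tor K × n) :
    ‖((covLapF K c m2 U)⁻¹ * ((((m2 + 2 * ((d : ℝ) + 1) * c : ℝ) : 𝕜)⁻¹) • (kingHopping K c m2).hop U) ^ N) p q‖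
      ≤ (∑ r, ‖(covLapF K c m2 U)⁻¹ p r‖) * (2 * ((d : ℝ) + 1) * c / (m2 + 2 * ((d : ℝ) + 1) * c)) ^ N := by
  rw [Matrix.mul_apply, Finset.sum_mul]
  refine (norm_sum_le _ _).trans (Finset.sum_le_sum fun r _ => ?_)
  rw [norm_mul]
  exact mul_le_mul_of_nonneg_left (norm_smul_hop_pow_entry_le K hc hm hU N r q) (norm_nonneg _)

/-- ★★ THE TERMS ARE DOMINATED BY THE FREE WALK TERMS: `|D₀^{−(k+1)}(T_U^k)((x,i),(y,j))| ≤ D₀^{−(k+1)}(T^k)(x,y)`. [cite: Balaban1985BackgroundPropagators, p.398 l.3–6] -/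
theorem norm_randomWalk_term_le (hc : 0 ≤ c) (hm : 0 < m2) {U : Tor K × Fin (d + 1) → Matrix n n 𝕜} (hU : ∀ b, U b ∈ Matrix.unitaryGroup n 𝕜)
    (k : ℕ) (x y : Tor K) (i j : n) :
    ‖(((m2 + 2 * ((d : ℝ) + 1) * c : ℝ) : 𝕜)⁻¹) ^ (k + 1) * ((kingHopping K c m2).hop U ^ k) (x, i) (y, j)‖
      ≤ (m2 + 2 * ((d : ℝ) + 1) * c)⁻¹ ^ (k + 1) * (kingHop K c ^ k) x y := by
  have hD0 : 0 < m2 + 2 * ((d : ℝ) + 1) * c := by positivity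
  rw [norm_mul, norm_pow, norm_inv, RCLike.norm_ofReal, abs_of_pos hD0]
  exact mul_le_mul_of_nonneg_left (norm_hop_pow_entry_le K hc m2 hU k x y i j) (pow_nonneg (inv_nonneg.2 hD0.le) _)

/-- ★★★ **THE RANDOM WALK REPRESENTATION OF THE COVARIANT FINE COVARIANCE**: for every unitary link field `U` (`c ≥ 0`, `m² > 0`), all `(x,i), (y,j)`:
`G_U((x,i),(y,j)) = Σ_{k≥0} D₀^{−(k+1)}·(T_U^k)((x,i),(y,j))` — the sum over nearest-neighbour walks `x → y` of `c^{|ω|}∕D₀^{|ω|+1}` times the ORDERED PRODUCT OF THE LINK VARIABLES along the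
walk; absolutely convergent, dominated termwise by King's `A = 0` expansion (PART Ͱ-k). [cite: Balaban1985BackgroundPropagators, p.398 l.3–6, (2.40) p.393; King1986, (4.4) p.670] -/
theorem hasSum_covariant_randomWalk (hc : 0 ≤ c) (hm : 0 < m2) {U : Tor K × Fin (d + 1) → Matrix n n 𝕜} (hU : ∀ b, U b ∈ Matrix.unitaryGroup n 𝕜)
    (x y : Tor K) (i j : n) :
    HasSum (fun k => (((m2 + 2 * ((d : ℝ) + 1) * c : ℝ) : 𝕜)⁻¹) ^ (k + 1) * ((kingHopping K c m2).hop U ^ k) (x, i) (y, j))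
      ((covLapF K c m2 U)⁻¹ (x, i) (y, j)) := by
  -- absolute convergence by the free majorant
  have hsumm : Summable (fun k => (((m2 + 2 * ((d : ℝ) + 1) * c : ℝ) : 𝕜)⁻¹) ^ (k + 1) * ((kingHopping K c m2).hop U ^ k) (x, i) (y, j)) :=
    Summable.of_norm_bounded (summable_kingHop_randomWalk K hc hm x y) (fun k => norm_randomWalk_term_le K hc hm hU k x y i j)
  -- the partial sums tend to `G_U`
  have hpart : ∀ N, ∑ k ∈ Finset.range N, (((m2 + 2 * ((d : ℝ) + 1) * c : ℝ) : 𝕜)⁻¹) ^ (k + 1) * ((kingHopping K c m2).hop U ^ k) (x, i) (y, j)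
      = (covLapF K c m2 U)⁻¹ (x, i) (y, j)
        - ((covLapF K c m2 U)⁻¹ * ((((m2 + 2 * ((d : ℝ) + 1) * c : ℝ) : 𝕜)⁻¹) • (kingHopping K c m2).hop U) ^ N) (x, i) (y, j) := fun N => by
    have h := congr_fun (congr_fun (partialSum_eq_inv_sub K hc hm hU N) (x, i)) (y, j)
    rw [Matrix.sum_apply] at h
    simpa only [Matrix.smul_apply, smul_eq_mul, Matrix.sub_apply] using h
  have hrem : Tendsto (fun N => ((covLapF K c m2 U)⁻¹ * ((((m2 + 2 * ((d : ℝ) + 1) * c : ℝ) : 𝕜)⁻¹) • (kingHopping K c m2).hop U) ^ N) (x, i) (y, j))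
      atTop (𝓝 0) := by
    have hgeo := tendsto_pow_atTop_nhds_zero_of_lt_one (theta_nonneg (d := d) hc hm) (theta_lt_one (d := d) hc hm)
    have hB := hgeo.const_mul (∑ r, ‖(covLapF K c m2 U)⁻¹ (x, i) r‖)
    rw [mul_zero] at hB
    exact squeeze_zero_norm (fun N => norm_remainder_entry_le K hc hm hU N (x, i) (y, j)) hB
  have hlim : Tendsto (fun N => ∑ k ∈ Finset.range N, (((m2 + 2 * ((d : ℝ) + 1) * c : ℝ) : 𝕜)⁻¹) ^ (k + 1) * ((kingHopping K c m2).hop U ^ k) (x, i) (y, j))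
      atTop (𝓝 ((covLapF K c m2 U)⁻¹ (x, i) (y, j))) := by
    simp only [hpart]
    have h := hrem.const_sub ((covLapF K c m2 U)⁻¹ (x, i) (y, j))
    rwa [sub_zero] at h
  have huniq := tendsto_nhds_unique hsumm.hasSum.tendsto_sum_nat hlim
  rw [← huniq]
  exact hsumm.hasSum

/-! ## §4 Kato domination re-derived by the random walk route -/

/-- ★★★ **KATO DOMINATION BY PRINT's ROUTE**: `|G_U((x,i),(y,j))| ≤ Σ_k D₀^{−(k+1)}(T^k)(x,y) = G(x,y)` for every unitary `U` — the covariant walk expansion is dominated term by term by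
King's `A = 0` walk expansion (each ordered product of `k` unitaries has norm `≤ 1`); this is Ͱ-b `norm_inv_entry_le_lapF_inv` obtained as in [B9] p.398 instead of by the maximum
principle. [cite: Balaban1985BackgroundPropagators, p.398 l.3–6, (3.42) p.397; DodziukMathai2006, Thm 1.5 §1; King1986, (4.4) p.670] -/
theorem norm_inv_entry_le_lapF_inv' (hc : 0 ≤ c) (hm : 0 < m2) {U : Tor K × Fin (d + 1) → Matrix n n 𝕜} (hU : ∀ b, U b ∈ Matrix.unitaryGroup n 𝕜)
    (x y : Tor K) (i j : n) :
    ‖(covLapF K c m2 U)⁻¹ (x, i) (y, j)‖ ≤ ∑' k, (m2 + 2 * ((d : ℝ) + 1) * c)⁻¹ ^ (k + 1) * (kingHop K c ^ k) x y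
      ∧ ∑' k, (m2 + 2 * ((d : ℝ) + 1) * c)⁻¹ ^ (k + 1) * (kingHop K c ^ k) x y = (lapF K c m2)⁻¹ x y := by
  have hW := hasSum_covariant_randomWalk K hc hm hU x y i j
  have hF := hasSum_kingHop_randomWalk K hc hm x y
  refine ⟨?_, hF.tsum_eq⟩
  rw [← hW.tsum_eq, hF.tsum_eq]
  exact (norm_tsum_le_tsum_norm hW.summable.norm).trans (hasSum_le (fun k => norm_randomWalk_term_le K hc hm hU k x y i j) hW.summable.norm.hasSum hF)

end Summit.QuantumFields.YangMills.BalabanUVNodes.N15KingModelRung.Covariant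

end
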